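import Mathlib
import HarnessLib
import Literature.Analysis.FluidPDE.Tao2016AveragedNS.LocalCascadeSolutions
import Literature.Analysis.FluidPDE.Tao2016AveragedNS.RenormalisedCascadeWaves
import Summits.NavierStokesRegularity.NavierStokesRegularity.Theorems.TaoLadderRungTwoBreakEternalRigidityViscBddOneDefs
import Summits.NavierStokesRegularity.NavierStokesRegularity.Theorems.TaoLadderRungTwoBreakEternalRigidityViscBddOneCriticalFront
import Summits.NavierStokesRegularity.NavierStokesRegularity.Theorems.TaoLadderRungTwoBreakEternalRigidityViscBddOneFrontClock

/-!
# Crux `TaoLadderRungTwoBreak.EternalRigidityViscBddOne` (stmt-NavierStokesRegularity-20420): a FRONT a=1 ENVELOPE gives the LOWER clock, hence a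
# TWO-SIDED clock at the critical front and a uniform window for the relative position of later fronts — the survival mechanism of the
# front-anchored (ω4) extraction, reduced to one hypothesis

MODEL lattice ODEs only (Tao 2016 §4: the exact NS-scaled `ν`-viscous cascade lattice of a table of `InTableClass R`, `m = 4`; registered vocabulary
`ViscousUpTo` / `TypeOne` of the skeleton `85fbfe8e90eea58b`); nothing here is a statement about the Navier–Stokes equations; no stub, crux or summit is
closed (`--supports stmt-NavierStokesRegularity-20420`).

The tree now has, along a type-I viscous blow-up, the UPPER clock `ν(1+ε₀)^{2F}(t⋆−t) < K₁` at every critical-front mode (`FrontClock.frontClock_of_typeOne`).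
A LOWER clock is equivalent to an a=1 ENVELOPE AT THE FRONT (`CriticalFront.le_frameViscosity_of_front`).  This file records the consequences of
such an envelope, as hypotheses-explicit algebra:
* `lowerClock_of_frontEnvelope` — if a front mode (`c ≤ Λ^F|X_{i,F}(t)|(t⋆−t)`) has `(1+ε₀)^{F/2}|X_{i,F}(t)| ≤ Q` then `cν/Q ≤ ν(1+ε₀)^{2F}(t⋆−t)`;
* `relativeShell_window` — TWO front modes `(F,t)`, `(F',t')` with two-sided clocks `m₁ ≤ ν(1+ε₀)^{2F}(t⋆−t) ≤ K₁`, `m₁ ≤ ν(1+ε₀)^{2F'}(t⋆−t') ≤ K₁`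
  and log-time offset `t⋆ − t' = (t⋆−t)e^{−σ}` satisfy `(m₁/K₁)e^{σ} ≤ (1+ε₀)^{2(F'−F)} ≤ (K₁/m₁)e^{σ}`: the later front sits in a window of
  `log(K₁/m₁)/log(1+ε₀)` shells around `F + σ/(2 log(1+ε₀))`, UNIFORMLY in the base point — the uniform hop clock;
* `frameWeightedEnergy_ge` — consequently the a=1-weighted energy of the frame recentred at `(F,t)`, evaluated at the later front
  (relative shell `n = F' − F`, log-offset `σ`), is `≥ c²(m₁/K₁)²` whenever the later front is non-degenerate (`‖frame‖ ≥ c`): the frames are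
  (S₁)-SURVIVING with a uniform constant, at shells `n ≍ σ/(2log(1+ε₀)) → ∞` — what `EternalSurvivingFwd 1` asks of the ω-limit, modulo the
  (pigeonhole + continuous-convergence) passage to the limit.
READING for ⟨20420⟩ (ω4): under type I the residual splits as (i) FRONT ENVELOPE `sup_t (1+ε₀)^{F(t)/2}|X_{F(t)}(t)| < ∞` (⟺ lower clock ⟺ `ν̂ > 0`
limit; gives survival by this file) and (ii) WAKE CALMING (gives `action`/`bdd`, evidence #38).  HONEST LABEL: algebraic bookkeeping; (ω3), (ω4),
⟨20420⟩ and every NS statement remain OPEN; rung 0.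
-/

noncomputable section

-- the summit and its single sub-problem share the name (CONVENTIONS §1)
set_option linter.dupNamespace false

open Set Filter Topology
open Literature.Analysis.FluidPDE Literature.Analysis.FluidPDE.TaoCascade
open Summit.NavierStokesRegularity.NavierStokesRegularity.Theorems.EternalRigidityViscBddOne.Birth

namespace Summit.NavierStokesRegularity.NavierStokesRegularity.Theorems.EternalRigidityViscBddOne.CriticalFront

/-- **Lower clock from a front envelope.**  A front mode `c ≤ Λ^F|X_{i,F}(t)|(t⋆−t)` (`c > 0`) with a=1 level bounded through
`(1+ε₀)^{F/2}|X_{i,F}(t)| ≤ Q` has frame viscosity `ν(1+ε₀)^{2F}(t⋆−t) ≥ cν/Q` (`ν ≥ 0`).  MODEL lattice only.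
[cite: Tao2016AveragedNS, §4 (4.1), §6.4; cell vocabulary (stmt-NavierStokesRegularity-20420)] -/
theorem lowerClock_of_frontEnvelope {ε₀ ν tStar t c Q : ℝ} (hε : -1 < ε₀) (hν : 0 ≤ ν) (hc : 0 < c) {X : Fin 4 → ℤ → ℝ → ℝ}
    {i : Fin 4} {F : ℤ} (hF : c ≤ bigLam ε₀ ^ F * |X i F t| * (tStar - t))
    (hQ : (1 + ε₀) ^ ((F : ℝ) / 2) * |X i F t| ≤ Q) :
    c * ν / Q ≤ ν * (1 + ε₀) ^ ((2 : ℝ) * F) * (tStar - t) := by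
  have hl0 : (0 : ℝ) < 1 + ε₀ := by linarith
  have hX : X i F t ≠ 0 := by
    intro h0
    rw [h0, abs_zero, mul_zero, zero_mul] at hF
    exact absurd hF (not_le.2 hc)
  have hq : 0 < (1 + ε₀) ^ ((F : ℝ) / 2) * |X i F t| := mul_pos (Real.rpow_pos_of_pos hl0 _) (abs_pos.2 hX)
  have hQ0 : 0 < Q := lt_of_lt_of_le hq hQ
  have h1 := le_frameViscosity_of_front hε hν hX hF
  have h2 : c * ν / Q ≤ c * ν / ((1 + ε₀) ^ ((F : ℝ) / 2) * |X i F t|) :=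
    div_le_div_of_nonneg_left (mul_nonneg hc.le hν) hq hQ
  exact h2.trans h1

/-- **The relative-shell window between two clocked fronts.**  If `m₁ ≤ ν(1+ε₀)^{2F}(T−t) ≤ K₁` and `m₁ ≤ ν(1+ε₀)^{2F'}(T−t') ≤ K₁` (`0 < m₁`),
`t < T`, and the log-time offset is `σ` (`T − t' = (T−t)e^{−σ}`), then `(m₁/K₁)e^{σ} ≤ (1+ε₀)^{2(F'−F)} ≤ (K₁/m₁)e^{σ}`: the later front sits within
`log(K₁/m₁)/(2log(1+ε₀))` shells of `F + σ/(2log(1+ε₀))`, uniformly in the base point.  Pure algebra.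
[cite: Tao2016AveragedNS, §4 (4.1), §6.4; cell vocabulary (stmt-NavierStokesRegularity-20420)] -/
theorem relativeShell_window {ε₀ ν T t t' σ m₁ K₁ : ℝ} (hε : -1 < ε₀) (hm₁ : 0 < m₁) (htT : t < T)
    {F F' : ℤ} (hlo : m₁ ≤ ν * (1 + ε₀) ^ ((2 : ℝ) * F) * (T - t)) (hhi : ν * (1 + ε₀) ^ ((2 : ℝ) * F) * (T - t) ≤ K₁)
    (hlo' : m₁ ≤ ν * (1 + ε₀) ^ ((2 : ℝ) * F') * (T - t')) (hhi' : ν * (1 + ε₀) ^ ((2 : ℝ) * F') * (T - t') ≤ K₁)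
    (hoff : T - t' = (T - t) * Real.exp (-σ)) :
    m₁ / K₁ * Real.exp σ ≤ (1 + ε₀) ^ ((2 : ℝ) * (F' - F)) ∧ (1 + ε₀) ^ ((2 : ℝ) * (F' - F)) ≤ K₁ / m₁ * Real.exp σ := by
  have hl0 : (0 : ℝ) < 1 + ε₀ := by linarith
  have hTt : 0 < T - t := by linarith
  have hK₁ : 0 < K₁ := lt_of_lt_of_le hm₁ (hlo.trans hhi)
  have heσ : 0 < Real.exp σ := Real.exp_pos σ
  -- `a = ν(1+ε₀)^{2F}(T-t)`, `a' = a · (1+ε₀)^{2(F'-F)} · e^{-σ}`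
  set a : ℝ := ν * (1 + ε₀) ^ ((2 : ℝ) * F) * (T - t) with ha
  set ρ : ℝ := (1 + ε₀) ^ ((2 : ℝ) * (F' - F)) with hρ
  have ha0 : 0 < a := lt_of_lt_of_le hm₁ hlo
  have hρ0 : 0 < ρ := Real.rpow_pos_of_pos hl0 _
  have hsplit : (1 + ε₀) ^ ((2 : ℝ) * F') = (1 + ε₀) ^ ((2 : ℝ) * F) * ρ := by
    rw [hρ, ← Real.rpow_add hl0]
    congr 1
    ring
  have ha' : ν * (1 + ε₀) ^ ((2 : ℝ) * F') * (T - t') = a * ρ * Real.exp (-σ) := by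
    rw [hsplit, hoff, ha]; ring
  rw [ha'] at hlo' hhi'
  have hexpneg : Real.exp (-σ) = (Real.exp σ)⁻¹ := Real.exp_neg σ
  rw [hexpneg] at hlo' hhi'
  -- `m₁ ≤ a ρ / e^σ ≤ K₁` with `m₁ ≤ a ≤ K₁`
  constructor
  · -- `ρ ≥ m₁ e^σ / a ≥ (m₁/K₁) e^σ`
    have h1 : m₁ * Real.exp σ ≤ a * ρ := by
      have := mul_le_mul_of_nonneg_right hlo' heσ.le
      rwa [mul_assoc, inv_mul_cancel₀ heσ.ne', mul_one] at this
    rw [div_mul_eq_mul_div, div_le_iff₀ hK₁]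
    calc m₁ * Real.exp σ ≤ a * ρ := h1
      _ ≤ K₁ * ρ := mul_le_mul_of_nonneg_right hhi hρ0.le
      _ = ρ * K₁ := mul_comm _ _
  · -- `ρ ≤ K₁ e^σ / a ≤ (K₁/m₁) e^σ`
    have h1 : a * ρ ≤ K₁ * Real.exp σ := by
      have := mul_le_mul_of_nonneg_right hhi' heσ.le
      rwa [mul_assoc, inv_mul_cancel₀ heσ.ne', mul_one] at this
    rw [div_mul_eq_mul_div, le_div_iff₀ hm₁]
    calc ρ * m₁ ≤ ρ * a := mul_le_mul_of_nonneg_left hlo hρ0.le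
      _ = a * ρ := mul_comm _ _
      _ ≤ K₁ * Real.exp σ := h1

/-- **Uniform a=1 survival of the clocked frames.**  In the situation of `relativeShell_window`, if the relative shell `n = F' − F` is a natural
number and the later front is non-degenerate in the frame, `c ≤ e^{−σ}·‖g‖`-free form: given `c² ≤ ‖v‖²` for the frame value `v` (the frame
recentred at `(F,t)` evaluated at relative shell `n` and log-offset `σ` has norm `Λ^{F'}(T−t')‖X_{F'}(t')‖ ≥ c`), the a=1-weighted energy obeys
`physWeight 1 ε₀ ^ n · (e^{2σ} ‖v‖²) ≥ c² (m₁/K₁)²` — a survival constant independent of the base point and of `n`.  Pure algebra.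
[cite: Tao2016AveragedNS, §4 (4.1), §6.4; cell vocabulary (`EternalSurvivingFwd`, stmt-NavierStokesRegularity-20420)] -/
theorem frameWeightedEnergy_ge {ε₀ σ m₁ K₁ c : ℝ} (hε : 0 < ε₀) (hm₁ : 0 < m₁) (hK₁ : 0 < K₁) (hc : 0 ≤ c) {n : ℕ}
    (hwin : (1 + ε₀) ^ ((2 : ℝ) * (n : ℤ)) ≤ K₁ / m₁ * Real.exp σ) {v : Em 4} (hv : c ≤ ‖v‖) :
    c ^ 2 * (m₁ / K₁) ^ 2 ≤ physWeight 1 ε₀ ^ n * (Real.exp (2 * σ) * ‖v‖ ^ 2) := by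
  have hl0 : (0 : ℝ) < 1 + ε₀ := by linarith
  have heσ : 0 < Real.exp σ := Real.exp_pos σ
  -- `physWeight 1 ε₀ ^ n = ((1+ε₀)^4)⁻¹ ^ n` and `(1+ε₀)^{2n}` as a natural power
  have hpw : physWeight 1 ε₀ = ((1 + ε₀) ^ 4)⁻¹ := by
    rw [physWeight, Real.rpow_one]
    field_simp
  have hP : (1 + ε₀) ^ ((2 : ℝ) * (n : ℤ)) = ((1 + ε₀) ^ 2) ^ n := by
    rw [show ((2 : ℝ) * ((n : ℤ) : ℝ)) = ((2 * n : ℕ) : ℝ) by push_cast; ring, Real.rpow_natCast, pow_mul]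
  rw [hP] at hwin
  set p : ℝ := ((1 + ε₀) ^ 2) ^ n with hpdef
  have hp0 : 0 < p := by rw [hpdef]; positivity
  have hwn : physWeight 1 ε₀ ^ n = (p ^ 2)⁻¹ := by
    rw [hpw, inv_pow, hpdef]
    congr 1
    rw [← pow_mul, ← pow_mul, ← pow_mul]
    ring_nf
  have he2 : Real.exp (2 * σ) = Real.exp σ ^ 2 := by
    rw [sq, ← Real.exp_add]; ring_nf
  have hp2 : p ^ 2 ≤ (K₁ / m₁ * Real.exp σ) ^ 2 := pow_le_pow_left₀ hp0.le hwin 2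
  have hv2 : c ^ 2 ≤ ‖v‖ ^ 2 := pow_le_pow_left₀ hc hv 2
  rw [hwn, he2]
  have hkey : (m₁ / K₁) ^ 2 ≤ (p ^ 2)⁻¹ * Real.exp σ ^ 2 := by
    rw [inv_mul_eq_div, le_div_iff₀ (pow_pos hp0 2)]
    calc (m₁ / K₁) ^ 2 * p ^ 2 ≤ (m₁ / K₁) ^ 2 * (K₁ / m₁ * Real.exp σ) ^ 2 :=
          mul_le_mul_of_nonneg_left hp2 (sq_nonneg _)
      _ = Real.exp σ ^ 2 := by field_simp
  calc c ^ 2 * (m₁ / K₁) ^ 2 ≤ ‖v‖ ^ 2 * ((p ^ 2)⁻¹ * Real.exp σ ^ 2) :=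
        mul_le_mul hv2 hkey (sq_nonneg _) (sq_nonneg _)
    _ = (p ^ 2)⁻¹ * (Real.exp σ ^ 2 * ‖v‖ ^ 2) := by ring

end Summit.NavierStokesRegularity.NavierStokesRegularity.Theorems.EternalRigidityViscBddOne.CriticalFront

end
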